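import Summits.AtomisticToContinuum.Crystallization.Theorems.OverbindingBudgetUniformCutLimit

/-!
# OverbindingBudget — record pins of the uniform cut (decomp-a2c lens-4, generation 25; line v8 «UniformCut»)

Helper file (`--supports stmt-AtomisticToContinuum-31280`, no new definitions): the two laws of the landed cone of record
`OverbindingBudgetUniformCutLimit.rdef_of_grossU_liouU_coherent` at the record margin `T₀ = 1/250` and core radius `10`,
PINNED to their fully expanded texts (every project-side definition — `ThinCores`, `ThinCoresL`, `GT`, `BarlowClose`,
`CleanT`, `RT` — unfolded down to Literature names, the loosened test `CleanT b (-s)` written with `+ s` / `- s`), so that a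
registered skeleton can state the stubs as self-contained texts and compose them through the tree BY NAME:

* `grossCleanBallsU_record_iff : GrossCleanBallsU (1/250) 10 ↔ (text)` — the PRICING residual GROSSᵘ;
* `cleanLiouvilleU_record_iff : CleanLiouvilleU (1/250) 10 ↔ (text)` — the blow-down law LIOUᵘ;
* `rdef_of_record_texts` — the cone of record restated over the four texts (GROSSᵘ, LIOUᵘ, and the generation-17/19 pins
  `cleanlessExcessT_iff`, `coherentResidual_ten_iff`), i.e. exactly the composition a v8 skeleton performs.
-/

namespace Summit.AtomisticToContinuum.Crystallization.Theorems.OverbindingBudgetUniformCutPins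

open Summit.AtomisticToContinuum.Crystallization.Theorems.OverbindingBudgetUniformCutStatements (GrossCleanBallsU CleanLiouvilleU)
open Summit.AtomisticToContinuum.Crystallization.Theorems.OverbindingBudgetUniformCutLimit (rdef_of_grossU_liouU_coherent)
open Summit.AtomisticToContinuum.Crystallization.Theorems.OverbindingBudgetGradedBareness (CleanlessExcessT cleanlessExcessT_iff)
open Summit.AtomisticToContinuum.Crystallization.Theorems.OverbindingBudgetCoherentCut (CoherentResidual coherentResidual_ten_iff)

/-- **Pin of GROSSᵘ at the record numerals.**  `GrossCleanBallsU (1/250) 10` is, by unfolding `ThinCores`/`GT`/`BarlowClose`/`RT`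
literally, the displayed text. [this file; defs: OverbindingBudgetUniformCutStatements, OverbindingBudgetWallTensionLever,
OverbindingBudgetViolatorDensityFloor] -/
theorem grossCleanBallsU_record_iff :
    GrossCleanBallsU (1 / 250) 10 ↔
    (∀ e : ℝ, Filter.Tendsto (fun N : ℕ => Literature.MathematicalPhysics.StatisticalMechanics.groundStateEnergy Literature.MathematicalPhysics.StatisticalMechanics.lennardJones 3 N / N) Filter.atTop (nhds e) → (∀ N : ℕ, 0 < N → e ≤ Literature.MathematicalPhysics.StatisticalMechanics.groundStateEnergy Literature.MathematicalPhysics.StatisticalMechanics.lennardJones 3 N / N) → ∀ Y : Set (EuclideanSpace ℝ (Fin 3)), Literature.MathematicalPhysics.StatisticalMechanics.UniformlyDiscrete Y → (∀ z : EuclideanSpace ℝ (Fin 3), ∃ w ∈ Y, dist z w < 9 / 10) → Literature.MathematicalPhysics.StatisticalMechanics.IsMuGSC Literature.MathematicalPhysics.StatisticalMechanics.lennardJones e Y → ∀ b : ℝ, 47 / 50 ≤ b → b ≤ 1 → (∀ z : EuclideanSpace ℝ (Fin 3), ∃ y ∈ Y, ({w ∈ Y | w ≠ y ∧ dist y w ≤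 b * (1 + 1 / 50)}.ncard = 12 ∧ ∀ w ∈ Y, w ≠ y → b * (1 - 1 / 50) ≤ dist y w ∧ (dist y w ≤ b * (1 + 1 / 50) ∨ b * (63 / 50) ≤ dist y w)) ∧ (∃ T : Finset (EuclideanSpace ℝ (Fin 3)), (↑T : Set (EuclideanSpace ℝ (Fin 3))) = (fun w => b⁻¹ • (w - y)) '' {w ∈ Y | w ≠ y ∧ dist y w ≤ b * (1 + 1 / 50)} ∧ (Literature.Geometry.DiscreteGeometry.ShellCloseTo (1 / 5) T Literature.Geometry.DiscreteGeometry.fccKissingPattern ∨ Literature.Geometry.DiscreteGeometry.ShellCloseTo (1 / 5) T Literature.Geometry.DiscreteGeometry.hcpKissingPattern)) ∧ dist z y ≤ 10) → ∀ L : ℝ, ∃ a : ℝ, 47 / 50 ≤ a ∧ a ≤ 1 ∧ ∃ q ∈ Y, ∀ y ∈ Y, dist y q ≤ L → ({w ∈ Y | w ≠ y ∧ dist y w < a * (63 / 50) - 1 / 250}.ncard ≤ 12 ∧ 12 ≤ {w ∈ Y | w ≠ y ∧ dist y w ≤ a * (1 + 1 / 50) + 1 / 250}.ncard ∧ ∀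 w ∈ Y, w ≠ y → a * (1 - 1 / 50) - 1 / 250 ≤ dist y w ∧ (dist y w ≤ a * (1 + 1 / 50) + 1 / 250 ∨ a * (63 / 50) - 1 / 250 ≤ dist y w))) := by
  unfold GrossCleanBallsU
    Summit.AtomisticToContinuum.Crystallization.Theorems.OverbindingBudgetWallTensionLever.ThinCores
    Summit.AtomisticToContinuum.Crystallization.Theorems.OverbindingBudgetViolatorDensityFloor.GT
    Summit.AtomisticToContinuum.Crystallization.Theorems.OverbindingBudgetWallTensionLever.BarlowClose
    Summit.AtomisticToContinuum.Crystallization.Theorems.OverbindingBudgetViolatorDensityFloor.RT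
  exact Iff.rfl

/-- **Pin of LIOUᵘ at the record numerals.**  `CleanLiouvilleU (1/250) 10` unfolded through `ThinCoresL`/`CleanT`/`RT`; the loosened
clean test `CleanT b (-s)` is displayed with `… + s` / `… - s` / `ShellCloseTo (1/5 + s)` (`sub_neg_eq_add`, `sub_eq_add_neg`). [this file] -/
theorem cleanLiouvilleU_record_iff :
    CleanLiouvilleU (1 / 250) 10 ↔
    (∀ e : ℝ, Filter.Tendsto (fun N : ℕ => Literature.MathematicalPhysics.StatisticalMechanics.groundStateEnergy Literature.MathematicalPhysics.StatisticalMechanics.lennardJones 3 N / N) Filter.atTop (nhds e) → (∀ N : ℕ, 0 < N → e ≤ Literature.MathematicalPhysics.StatisticalMechanics.groundStateEnergy Literature.MathematicalPhysics.StatisticalMechanics.lennardJones 3 N / N) → ∀ Y : Set (EuclideanSpace ℝ (Fin 3)), Literature.MathematicalPhysics.StatisticalMechanics.UniformlyDiscrete Y → (∀ z : EuclideanSpace ℝ (Fin 3), ∃ w ∈ Y, dist z w ≤ 9 / 10) → Literature.MathematicalPhysics.StatisticalMechanics.IsMuGSC Literature.MathematicalPhysics.StatisticalMechanics.lennardJones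 e Y → ∀ b : ℝ, 47 / 50 ≤ b → b ≤ 1 → (∀ z : EuclideanSpace ℝ (Fin 3), ∃ y ∈ Y, dist z y ≤ 10 ∧ ∀ s : ℝ, 0 < s → s < 1 / 100 → ({w ∈ Y | w ≠ y ∧ dist y w ≤ b * (1 + 1 / 50) + s}.ncard = 12 ∧ (∀ w ∈ Y, w ≠ y → b * (1 - 1 / 50) - s ≤ dist y w ∧ (dist y w ≤ b * (1 + 1 / 50) + s ∨ b * (63 / 50) - s ≤ dist y w)) ∧ (∃ T : Finset (EuclideanSpace ℝ (Fin 3)), (↑T : Set (EuclideanSpace ℝ (Fin 3))) = (fun w => b⁻¹ • (w - y)) '' {w ∈ Y | w ≠ y ∧ dist y w ≤ b * (1 + 1 / 50)} ∧ (Literature.Geometry.DiscreteGeometry.ShellCloseTo (1 / 5 + s) T Literature.Geometry.DiscreteGeometry.fccKissingPattern ∨ Literature.Geometry.DiscreteGeometry.ShellCloseTo (1 / 5 + s) T Literature.Geometry.DiscreteGeometry.hcpKissingPattern)))) → ∀ a : ℝ, 47 / 50 ≤ a → a ≤ 1 → (∀ y ∈ Y, ({w ∈ Y | w ≠ y ∧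 dist y w < a * (63 / 50) - 1 / 250}.ncard ≤ 12 ∧ 12 ≤ {w ∈ Y | w ≠ y ∧ dist y w ≤ a * (1 + 1 / 50) + 1 / 250}.ncard ∧ ∀ w ∈ Y, w ≠ y → a * (1 - 1 / 50) - 1 / 250 ≤ dist y w ∧ (dist y w ≤ a * (1 + 1 / 50) + 1 / 250 ∨ a * (63 / 50) - 1 / 250 ≤ dist y w))) → ∀ t : ℝ, 0 < t → ∃ a' : ℝ, 47 / 50 ≤ a' ∧ a' ≤ 1 ∧ ∀ y ∈ Y, ({w ∈ Y | w ≠ y ∧ dist y w < a' * (63 / 50) - t}.ncard ≤ 12 ∧ 12 ≤ {w ∈ Y | w ≠ y ∧ dist y w ≤ a' * (1 + 1 / 50) + t}.ncard ∧ ∀ w ∈ Y, w ≠ y → a' * (1 - 1 / 50) - t ≤ dist y w ∧ (dist y w ≤ a' * (1 + 1 / 50) + t ∨ a' * (63 / 50) - t ≤ dist y w))) := by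
  unfold CleanLiouvilleU
    Summit.AtomisticToContinuum.Crystallization.Theorems.OverbindingBudgetRecurrentDustStatements.ThinCoresL
    Summit.AtomisticToContinuum.Crystallization.Theorems.OverbindingBudgetWallTensionLever.CleanT
    Summit.AtomisticToContinuum.Crystallization.Theorems.OverbindingBudgetViolatorDensityFloor.RT
  simp only [sub_neg_eq_add, ← sub_eq_add_neg]

/-- **The cone of record over texts.**  The four displayed texts (GROSSᵘ, LIOUᵘ at `(1/250, 10)`, the graded cleanless-excess law,
the coherent residual at radius `10`) give `RobustDefectLimitWindows` — through the pins and `rdef_of_grossU_liouU_coherent` BY NAME.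
[this file; OverbindingBudgetUniformCutLimit] -/
theorem rdef_of_record_texts
    (hG : ∀ e : ℝ, Filter.Tendsto (fun N : ℕ => Literature.MathematicalPhysics.StatisticalMechanics.groundStateEnergy Literature.MathematicalPhysics.StatisticalMechanics.lennardJones 3 N / N) Filter.atTop (nhds e) → (∀ N : ℕ, 0 < N → e ≤ Literature.MathematicalPhysics.StatisticalMechanics.groundStateEnergy Literature.MathematicalPhysics.StatisticalMechanics.lennardJones 3 N / N) → ∀ Y : Set (EuclideanSpace ℝ (Fin 3)), Literature.MathematicalPhysics.StatisticalMechanics.UniformlyDiscrete Y → (∀ z : EuclideanSpace ℝ (Fin 3), ∃ w ∈ Y, dist z w < 9 / 10) → Literature.MathematicalPhysics.StatisticalMechanics.IsMuGSC Literature.MathematicalPhysics.StatisticalMechanics.lennardJones e Y → ∀ b : ℝ, 47 / 50 ≤ b → b ≤ 1 → (∀ z : EuclideanSpace ℝ (Fin 3), ∃ y ∈ Y, ({w ∈ Y | w ≠ y ∧ dist y w ≤ b * (1 + 1 / 50)}.ncard = 12 ∧ ∀ w ∈ Y, w ≠ y → b * (1 - 1 / 50) ≤ dist y w ∧ (dist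 y w ≤ b * (1 + 1 / 50) ∨ b * (63 / 50) ≤ dist y w)) ∧ (∃ T : Finset (EuclideanSpace ℝ (Fin 3)), (↑T : Set (EuclideanSpace ℝ (Fin 3))) = (fun w => b⁻¹ • (w - y)) '' {w ∈ Y | w ≠ y ∧ dist y w ≤ b * (1 + 1 / 50)} ∧ (Literature.Geometry.DiscreteGeometry.ShellCloseTo (1 / 5) T Literature.Geometry.DiscreteGeometry.fccKissingPattern ∨ Literature.Geometry.DiscreteGeometry.ShellCloseTo (1 / 5) T Literature.Geometry.DiscreteGeometry.hcpKissingPattern)) ∧ dist z y ≤ 10) → ∀ L : ℝ, ∃ a : ℝ, 47 / 50 ≤ a ∧ a ≤ 1 ∧ ∃ q ∈ Y, ∀ y ∈ Y, dist y q ≤ L → ({w ∈ Y | w ≠ y ∧ dist y w < a * (63 / 50) - 1 / 250}.ncard ≤ 12 ∧ 12 ≤ {w ∈ Y | w ≠ y ∧ dist y w ≤ a * (1 + 1 / 50) + 1 / 250}.ncard ∧ ∀ w ∈ Y, w ≠ y → a * (1 - 1 / 50) - 1 / 250 ≤ dist y w ∧ (dist y w ≤ a * (1 + 1 / 50) + 1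 / 250 ∨ a * (63 / 50) - 1 / 250 ≤ dist y w)))
    (hL : ∀ e : ℝ, Filter.Tendsto (fun N : ℕ => Literature.MathematicalPhysics.StatisticalMechanics.groundStateEnergy Literature.MathematicalPhysics.StatisticalMechanics.lennardJones 3 N / N) Filter.atTop (nhds e) → (∀ N : ℕ, 0 < N → e ≤ Literature.MathematicalPhysics.StatisticalMechanics.groundStateEnergy Literature.MathematicalPhysics.StatisticalMechanics.lennardJones 3 N / N) → ∀ Y : Set (EuclideanSpace ℝ (Fin 3)), Literature.MathematicalPhysics.StatisticalMechanics.UniformlyDiscrete Y → (∀ z : EuclideanSpace ℝ (Fin 3), ∃ w ∈ Y, dist z w ≤ 9 / 10) → Literature.MathematicalPhysics.StatisticalMechanics.IsMuGSC Literature.MathematicalPhysics.StatisticalMechanics.lennardJones e Y → ∀ b : ℝ, 47 / 50 ≤ b → b ≤ 1 → (∀ z : EuclideanSpace ℝ (Fin 3), ∃ y ∈ Y, dist z y ≤ 10 ∧ ∀ s : ℝ, 0 < s → s < 1 / 100 → ({w ∈ Y | w ≠ y ∧ dist y w ≤ b * (1 + 1 / 50) + s}.ncard = 12 ∧ (∀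 w ∈ Y, w ≠ y → b * (1 - 1 / 50) - s ≤ dist y w ∧ (dist y w ≤ b * (1 + 1 / 50) + s ∨ b * (63 / 50) - s ≤ dist y w)) ∧ (∃ T : Finset (EuclideanSpace ℝ (Fin 3)), (↑T : Set (EuclideanSpace ℝ (Fin 3))) = (fun w => b⁻¹ • (w - y)) '' {w ∈ Y | w ≠ y ∧ dist y w ≤ b * (1 + 1 / 50)} ∧ (Literature.Geometry.DiscreteGeometry.ShellCloseTo (1 / 5 + s) T Literature.Geometry.DiscreteGeometry.fccKissingPattern ∨ Literature.Geometry.DiscreteGeometry.ShellCloseTo (1 / 5 + s) T Literature.Geometry.DiscreteGeometry.hcpKissingPattern)))) → ∀ a : ℝ, 47 / 50 ≤ a → a ≤ 1 → (∀ y ∈ Y, ({w ∈ Y | w ≠ y ∧ dist y w < a * (63 / 50) - 1 / 250}.ncard ≤ 12 ∧ 12 ≤ {w ∈ Y | w ≠ y ∧ dist y w ≤ a * (1 + 1 / 50) + 1 / 250}.ncard ∧ ∀ w ∈ Y, w ≠ y → a * (1 - 1 / 50) - 1 / 250 ≤ dist y w ∧ (dist y w ≤ a * (1 + 1 / 50)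 + 1 / 250 ∨ a * (63 / 50) - 1 / 250 ≤ dist y w))) → ∀ t : ℝ, 0 < t → ∃ a' : ℝ, 47 / 50 ≤ a' ∧ a' ≤ 1 ∧ ∀ y ∈ Y, ({w ∈ Y | w ≠ y ∧ dist y w < a' * (63 / 50) - t}.ncard ≤ 12 ∧ 12 ≤ {w ∈ Y | w ≠ y ∧ dist y w ≤ a' * (1 + 1 / 50) + t}.ncard ∧ ∀ w ∈ Y, w ≠ y → a' * (1 - 1 / 50) - t ≤ dist y w ∧ (dist y w ≤ a' * (1 + 1 / 50) + t ∨ a' * (63 / 50) - t ≤ dist y w)))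
    (hCE : CleanlessExcessT) (hR : CoherentResidual 10) :
    Summit.AtomisticToContinuum.Crystallization.Theses.OverbindingBudget.RobustDefectLimitWindows :=
  rdef_of_grossU_liouU_coherent (T₀ := 1 / 250) (by norm_num) (grossCleanBallsU_record_iff.2 hG)
    (cleanLiouvilleU_record_iff.2 hL) hCE hR

end Summit.AtomisticToContinuum.Crystallization.Theorems.OverbindingBudgetUniformCutPins
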